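import Literature.MathematicalPhysics.QuantumLattice.HeisenbergCorrelationGramWindows

/-!
# R91 route (R-a): the collected-coefficient reindexing identities `RpRowCollected` / `PosRowCollected`

HONEST FRAMING: ladder R1–R4 with certified numbers; no claim on H/H₀.  Pure finite-sum bookkeeping: the
reflection-positivity Gram window inequality `heis_rpGramWindow_range` (DLS Thm 4.2 / KLS eq. (25)) and the
positivity window inequality `heis_transGramWindow_range`, regrouped by the correlator argument
`(a, b) = (i+i'+1, |t-t'|)` resp. `(|i-i'|, |t-t'|)`, with INTEGER coefficients computed by the structural-recursive
functions `dot` / `lag` / `rpCollect` / `posCollect` of r2 g34's SPEC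
(`pub-hubbard-r2/axis-g34/r91/probe/R91RaSpec.lean` 5f86df494526bd48; definitions copied VERBATIM so that
`decide`-evaluated tables of the probe files transfer).  Pen: r2-eng-2 g3 (lead g24 GO, HOME/INBOX l.3390).
No new axioms, no `native_decide`.
-/

namespace Summit.HubbardSuperconductivity.HubbardLadder.R91Ra

open Finset Literature.MathematicalPhysics.QuantumLattice

/-- truncated dot product (SPEC, verbatim). -/
def dot : List ℤ → List ℤ → ℤ
  | x :: xs, y :: ys => x * y + dot xs ys
  | _, _ => 0

/-- `Σ_{t,t'} [|t - t'| = b] u_t v_{t'}` for rows of equal length (SPEC, verbatim). -/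
def lag (u v : List ℤ) (b : ℕ) : ℤ :=
  if b = 0 then dot u v else dot u (v.drop b) + dot v (u.drop b)

/-- coefficient of `c(a,b)` in the RP window form: `Σ_{i+i'+1 = a} lag (V i) (V i') b` (SPEC, verbatim). -/
def rpCollect (V : List (List ℤ)) (a b : ℕ) : ℤ :=
  ((List.range a).map fun i => lag (V.getD i []) (V.getD (a - 1 - i) []) b).sum

/-- the raw RP table, row-major `a < 2·|V|+1`, `b < w` (SPEC, verbatim). -/
def rpTable (V : List (List ℤ)) (w : ℕ) : List ℤ :=
  ((List.range (2 * V.length + 1)).map fun a => (List.range w).map fun b => rpCollect V a b).flatten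

/-- coefficient of `c(da,db)` in the translation (POS) window form (SPEC, verbatim). -/
def posCollect (V : List (List ℤ)) (da db : ℕ) : ℤ :=
  if da = 0 then ((List.range V.length).map fun i => lag (V.getD i []) (V.getD i []) db).sum
  else ((List.range (V.length - da)).map fun i => 2 * lag (V.getD i []) (V.getD (i + da) []) db).sum

/-- the integer window table read as the real test vector of the range theorems (SPEC, verbatim). -/
def tab (V : List (List ℤ)) (i t : ℕ) : ℝ := (((V.getD i []).getD t 0 : ℤ) : ℝ)

/-- SPEC statement (verbatim): the RP window inequality in collected form. -/
def RpRowCollected : Prop :=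
  ∀ (k : ℕ) [NeZero (2 * k)] (n m w : ℕ) (_ : m ≤ k) (V : List (List ℤ)),
    V.length = m → (∀ r ∈ V, r.length = w) →
      0 ≤ ∑ a ∈ range (2 * m), ∑ b ∈ range w,
        (rpCollect V a b : ℝ) * -heisRedCorr2 (2 * k) n a b

/-- SPEC statement (verbatim): the POS window inequality in collected form. -/
def PosRowCollected : Prop :=
  ∀ (L : ℕ) [NeZero L] (n s : ℕ) (V : List (List ℤ)),
    V.length = s → (∀ r ∈ V, r.length = s) →
      0 ≤ ∑ da ∈ range s, ∑ db ∈ range s,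
        (posCollect V da db : ℝ) * heisRedCorr2 L n da db

/-! ### List bookkeeping -/

/-- `dot [] v = 0`. -/
theorem dot_nil_left (v : List ℤ) : dot [] v = 0 := by
  cases v <;> rfl

/-- `dot u [] = 0`. -/
theorem dot_nil_right (u : List ℤ) : dot u [] = 0 := by
  cases u <;> rfl

/-- the recursive step of `dot`. -/
theorem dot_cons_cons (x y : ℤ) (xs ys : List ℤ) : dot (x :: xs) (y :: ys) = x * y + dot xs ys := rfl

/-- `dot` as a sum over the positions of the first list (the second list is read with default `0`). -/
theorem dot_eq_sum (u v : List ℤ) : dot u v = ∑ t ∈ range u.length, u.getD t 0 * v.getD t 0 := by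
  induction u generalizing v with
  | nil => simp [dot_nil_left]
  | cons x xs ih =>
    cases v with
    | nil => simp [dot_nil_right]
    | cons y ys =>
      rw [dot_cons_cons, List.length_cons, Finset.sum_range_succ']
      simp only [List.getD_cons_succ, List.getD_cons_zero]
      rw [ih ys]
      ring

/-- `lag [] v b = 0`. -/
theorem lag_nil_left (v : List ℤ) (b : ℕ) : lag [] v b = 0 := by
  unfold lag
  split_ifs <;> simp [dot_nil_left, dot_nil_right]

/-- `lag u [] b = 0`. -/
theorem lag_nil_right (u : List ℤ) (b : ℕ) : lag u [] b = 0 := by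
  unfold lag
  split_ifs <;> simp [dot_nil_left, dot_nil_right]

/-- reading an integer list past its end with default `0` gives `0`. -/
theorem getD_int_eq_zero (l : List ℤ) (n : ℕ) (h : l.length ≤ n) : l.getD n 0 = 0 := by
  rw [List.getD_eq_getElem?_getD, List.getElem?_eq_none_iff.mpr h]
  rfl

/-- `(v.drop b).getD t 0 = v.getD (b + t) 0`. -/
theorem getD_drop_int (v : List ℤ) (b t : ℕ) : (v.drop b).getD t 0 = v.getD (b + t) 0 := by
  simp [List.getD_eq_getElem?_getD, List.getElem?_drop]

/-- `dot u (v.drop b)` as a sum over `range w` when `u` has length `w`. -/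
theorem dot_drop_eq_sum (u v : List ℤ) (b w : ℕ) (hu : u.length = w) :
    dot u (v.drop b) = ∑ t ∈ range w, u.getD t 0 * v.getD (b + t) 0 := by
  rw [dot_eq_sum, hu]
  refine Finset.sum_congr rfl fun t _ => ?_
  rw [getD_drop_int]

/-! ### The transverse regrouping: `lag` is the fibre sum of `u_t v_{t'}` over `|t - t'| = b` -/

/-- `|t - t'| = b` for naturals, as the two orientations. -/
theorem natAbs_sub_natCast_eq_iff (t t' b : ℕ) :
    Int.natAbs ((t : ℤ) - t') = b ↔ (t = t' + b ∨ t' = t + b) := by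
  rw [Int.natAbs_eq_iff]
  omega

/-- `((List.range n).map f).sum` as a `Finset.range` sum. -/
theorem list_sum_map_range (f : ℕ → ℤ) (n : ℕ) : ((List.range n).map f).sum = ∑ i ∈ range n, f i := by
  induction n with
  | zero => simp
  | succ n ih => simp [List.range_succ, Finset.sum_range_succ, ih]

/-- fibre of the transverse offset: for rows `u, v` of length `w` and any `b`,
`Σ_{t,t' < w, |t-t'| = b} u_t v_{t'} = lag u v b`. -/
theorem lag_eq_fiber (u v : List ℤ) (w : ℕ) (hu : u.length = w) (hv : v.length = w) (b : ℕ) :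
    (∑ p ∈ (range w ×ˢ range w).filter (fun p : ℕ × ℕ => Int.natAbs ((p.1 : ℤ) - p.2) = b),
      u.getD p.1 0 * v.getD p.2 0) = lag u v b := by
  rw [Finset.sum_filter, Finset.sum_product]
  by_cases hb : b = 0
  · subst hb
    have hcond : ∀ t t' : ℕ, (Int.natAbs ((t : ℤ) - t') = 0) ↔ t = t' := by
      intro t t'; rw [natAbs_sub_natCast_eq_iff]; omega
    simp_rw [hcond, Finset.sum_ite_eq, Finset.mem_range]
    unfold lag
    simp only [if_true]
    rw [dot_eq_sum, hu]
    refine Finset.sum_congr rfl fun t ht => ?_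
    rw [Finset.mem_range] at ht
    simp [ht]
  · -- b ≠ 0: the fibre splits into the two orientations t = t' + b and t' = t + b (disjoint)
    have hsplit : ∀ t t' : ℕ, (if Int.natAbs ((t : ℤ) - t') = b then u.getD t 0 * v.getD t' 0 else 0) =
        (if t' = t + b then u.getD t 0 * v.getD t' 0 else 0) + (if t = t' + b then u.getD t 0 * v.getD t' 0 else 0) := by
      intro t t'
      have key := natAbs_sub_natCast_eq_iff t t' b
      by_cases h1 : t' = t + b
      · have hc : Int.natAbs ((t : ℤ) - t') = b := key.mpr (Or.inr h1)
        have h2 : ¬ t = t' + b := by omega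
        rw [if_pos hc, if_pos h1, if_neg h2, add_zero]
      · by_cases h2 : t = t' + b
        · have hc : Int.natAbs ((t : ℤ) - t') = b := key.mpr (Or.inl h2)
          rw [if_pos hc, if_neg h1, if_pos h2, zero_add]
        · have hc : ¬ Int.natAbs ((t : ℤ) - t') = b := fun h => by
            rcases key.mp h with h | h <;> omega
          rw [if_neg hc, if_neg h1, if_neg h2, add_zero]
    simp_rw [hsplit, Finset.sum_add_distrib]
    -- first orientation: Σ_t Σ_t' [t' = t+b] u_t v_t' = Σ_t u_t v_{t+b} = dot u (v.drop b)
    have h1 : (∑ t ∈ range w, ∑ t' ∈ range w, if t' = t + b then u.getD t 0 * v.getD t' 0 else 0) = dot u (v.drop b) := by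
      rw [dot_drop_eq_sum u v b w hu]
      refine Finset.sum_congr rfl fun t _ => ?_
      rw [Finset.sum_ite_eq' (range w) (t + b) (fun t' => u.getD t 0 * v.getD t' 0)]
      by_cases h : t + b ∈ range w
      · rw [if_pos h, Nat.add_comm b t]
      · rw [if_neg h]
        rw [Finset.mem_range, not_lt] at h
        rw [Nat.add_comm b t, getD_int_eq_zero v (t + b) (by omega), mul_zero]
    -- second orientation: Σ_t Σ_t' [t = t'+b] u_t v_t' = Σ_t' v_t' u_{t'+b} = dot v (u.drop b)
    have h2 : (∑ t ∈ range w, ∑ t' ∈ range w, if t = t' + b then u.getD t 0 * v.getD t' 0 else 0) = dot v (u.drop b) := by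
      rw [Finset.sum_comm, dot_drop_eq_sum v u b w hv]
      refine Finset.sum_congr rfl fun t' _ => ?_
      rw [Finset.sum_ite_eq' (range w) (t' + b) (fun t => u.getD t 0 * v.getD t' 0)]
      by_cases h : t' + b ∈ range w
      · rw [if_pos h, Nat.add_comm b t', mul_comm]
      · rw [if_neg h]
        rw [Finset.mem_range, not_lt] at h
        rw [Nat.add_comm b t', getD_int_eq_zero u (t' + b) (by omega), mul_zero]
    rw [h1, h2]
    unfold lag
    rw [if_neg hb]

/-- the transverse regrouping with a weight: `Σ_b lag(u,v,b) g b = Σ_{t,t'} u_t v_{t'} g |t-t'|` (rows of length `w`). -/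
theorem sum_lag_mul (u v : List ℤ) (w : ℕ) (hu : u.length = w) (hv : v.length = w) (g : ℕ → ℝ) :
    ∑ b ∈ range w, (lag u v b : ℝ) * g b =
      ∑ t ∈ range w, ∑ t' ∈ range w, (u.getD t 0 : ℝ) * (v.getD t' 0 : ℝ) * g (Int.natAbs ((t : ℤ) - t')) := by
  rw [← Finset.sum_product' (range w) (range w)
    (fun t t' => (u.getD t 0 : ℝ) * (v.getD t' 0 : ℝ) * g (Int.natAbs ((t : ℤ) - t')))]
  rw [← Finset.sum_fiberwise_of_maps_to (s := range w ×ˢ range w) (t := range w)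
    (g := fun p : ℕ × ℕ => Int.natAbs ((p.1 : ℤ) - p.2)) (fun p hp => by
      rw [Finset.mem_product, Finset.mem_range, Finset.mem_range] at hp
      rw [Finset.mem_range]; omega)]
  refine Finset.sum_congr rfl fun b _ => ?_
  rw [← lag_eq_fiber u v w hu hv b]
  push_cast
  rw [Finset.sum_mul]
  refine Finset.sum_congr rfl fun p hp => ?_
  rw [Finset.mem_filter] at hp
  rw [hp.2]

/-! ### The row regrouping: `rpCollect` is the fibre sum of `lag (V i) (V i')` over `i + i' + 1 = a` -/

/-- a row index past the table reads the empty row. -/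
theorem getD_row_eq_nil (V : List (List ℤ)) (i : ℕ) (h : V.length ≤ i) : V.getD i [] = [] := by
  rw [List.getD_eq_getElem?_getD, List.getElem?_eq_none_iff.mpr h]
  rfl

/-- an in-range row read with `getD` is a member of the table. -/
theorem getD_row_mem (V : List (List ℤ)) (i : ℕ) (h : i < V.length) : V.getD i [] ∈ V := by
  rw [List.getD_eq_getElem?_getD, List.getElem?_eq_getElem h]
  exact List.getElem_mem h

/-- fibre of the row index: `Σ_{i,i' < m, i+i'+1 = a} lag (V i) (V i') b = rpCollect V a b` (rows beyond the table are `[]`). -/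
theorem rpCollect_eq_fiber (V : List (List ℤ)) (m : ℕ) (hV : V.length = m) (a b : ℕ) :
    (∑ p ∈ (range m ×ˢ range m).filter (fun p : ℕ × ℕ => p.1 + p.2 + 1 = a),
      lag (V.getD p.1 []) (V.getD p.2 []) b) = rpCollect V a b := by
  rw [Finset.sum_filter, Finset.sum_product]
  have inner : ∀ i ∈ range m, (∑ i' ∈ range m, if i + i' + 1 = a then lag (V.getD i []) (V.getD i' []) b else 0) =
      if i + 1 ≤ a ∧ a - 1 - i < m then lag (V.getD i []) (V.getD (a - 1 - i) []) b else 0 := by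
    intro i _
    by_cases h : i + 1 ≤ a
    · have hiff : ∀ i', (i + i' + 1 = a ↔ i' = a - 1 - i) := by intro i'; omega
      simp_rw [hiff]
      rw [Finset.sum_ite_eq' (range m) (a - 1 - i) (fun i' => lag (V.getD i []) (V.getD i' []) b)]
      by_cases h' : a - 1 - i < m
      · rw [if_pos (Finset.mem_range.mpr h'), if_pos ⟨h, h'⟩]
      · rw [if_neg (fun hh => h' (Finset.mem_range.mp hh)), if_neg (fun hh => h' hh.2)]
    · have hno : ∀ i', ¬ (i + i' + 1 = a) := by intro i'; omega
      simp_rw [if_neg (hno _)]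
      rw [Finset.sum_const_zero, if_neg (fun hh => h hh.1)]
  rw [Finset.sum_congr rfl inner]
  -- the SPEC side
  unfold rpCollect
  rw [list_sum_map_range]
  have outer : ∀ i ∈ range a, lag (V.getD i []) (V.getD (a - 1 - i) []) b =
      if i < m ∧ a - 1 - i < m then lag (V.getD i []) (V.getD (a - 1 - i) []) b else 0 := by
    intro i _
    by_cases h1 : i < m
    · by_cases h2 : a - 1 - i < m
      · rw [if_pos ⟨h1, h2⟩]
      · rw [if_neg (fun hh => h2 hh.2), getD_row_eq_nil V (a - 1 - i) (by omega), lag_nil_right]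
    · rw [if_neg (fun hh => h1 hh.1), getD_row_eq_nil V i (by omega), lag_nil_left]
  rw [Finset.sum_congr rfl outer, ← Finset.sum_filter, ← Finset.sum_filter]
  refine Finset.sum_congr ?_ fun _ _ => rfl
  ext i
  simp only [Finset.mem_filter, Finset.mem_range]
  omega

/-- the row regrouping with a weight: `Σ_{a<2m} rpCollect V a b · h a = Σ_{i,i'<m} lag (V i) (V i') b · h (i+i'+1)`. -/
theorem sum_rpCollect_mul (V : List (List ℤ)) (m : ℕ) (hV : V.length = m) (b : ℕ) (h : ℕ → ℝ) :
    ∑ a ∈ range (2 * m), (rpCollect V a b : ℝ) * h a =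
      ∑ i ∈ range m, ∑ i' ∈ range m, (lag (V.getD i []) (V.getD i' []) b : ℝ) * h (i + i' + 1) := by
  rw [← Finset.sum_product' (range m) (range m) (fun i i' => (lag (V.getD i []) (V.getD i' []) b : ℝ) * h (i + i' + 1))]
  rw [← Finset.sum_fiberwise_of_maps_to (s := range m ×ˢ range m) (t := range (2 * m))
    (g := fun p : ℕ × ℕ => p.1 + p.2 + 1) (fun p hp => by
      rw [Finset.mem_product, Finset.mem_range, Finset.mem_range] at hp
      rw [Finset.mem_range]; omega)]
  refine Finset.sum_congr rfl fun a _ => ?_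
  rw [← rpCollect_eq_fiber V m hV a b]
  push_cast
  rw [Finset.sum_mul]
  refine Finset.sum_congr rfl fun p hp => ?_
  rw [Finset.mem_filter] at hp
  rw [hp.2]

/-! ### `RpRowCollected` -/

/-- **The RP Gram window inequality in collected form** (r2 g34's SPEC `RpRowCollected`): for an integer table
`V` with `m ≤ k` rows of length `w`, `0 ≤ Σ_{a<2m} Σ_{b<w} rpCollect V a b · (−c_{2k}(a,b))`.
[cite: DLS1978, Theorem 4.2] [cite: KLS1988JSP, eq. (25)] -/
theorem rpRowCollected : RpRowCollected := by
  intro k _ n m w hm V hV hrow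
  have hlen : ∀ i, i < m → (V.getD i []).length = w := fun i hi =>
    hrow _ (getD_row_mem V i (by omega))
  have h := heis_rpGramWindow_range k n m w hm (tab V)
  have hR : (∑ i ∈ range m, ∑ t ∈ range w, ∑ i' ∈ range m, ∑ t' ∈ range w,
      tab V i t * tab V i' t' * -heisRedCorr2 (2 * k) n (i + i' + 1) (Int.natAbs ((t : ℤ) - t'))) =
      ∑ i ∈ range m, ∑ i' ∈ range m, ∑ b ∈ range w,
        (lag (V.getD i []) (V.getD i' []) b : ℝ) * -heisRedCorr2 (2 * k) n (i + i' + 1) b := by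
    refine Finset.sum_congr rfl fun i hi => ?_
    rw [Finset.sum_comm]
    refine Finset.sum_congr rfl fun i' hi' => ?_
    rw [Finset.mem_range] at hi hi'
    exact (sum_lag_mul (V.getD i []) (V.getD i' []) w (hlen i hi) (hlen i' hi')
      (fun b => -heisRedCorr2 (2 * k) n (i + i' + 1) b)).symm
  rw [hR] at h
  have hL : (∑ a ∈ range (2 * m), ∑ b ∈ range w, (rpCollect V a b : ℝ) * -heisRedCorr2 (2 * k) n a b) =
      ∑ i ∈ range m, ∑ i' ∈ range m, ∑ b ∈ range w,
        (lag (V.getD i []) (V.getD i' []) b : ℝ) * -heisRedCorr2 (2 * k) n (i + i' + 1) b := by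
    rw [Finset.sum_comm]
    rw [Finset.sum_congr rfl fun b _ => sum_rpCollect_mul V m hV b (fun a => -heisRedCorr2 (2 * k) n a b)]
    rw [Finset.sum_comm]
    refine Finset.sum_congr rfl fun i _ => ?_
    rw [Finset.sum_comm]
  rw [hL]
  exact h

/-! ### The row format consumed downstream: a ready-to-instantiate corollary per window
(the coefficient table is `rpCollect V a b` / `posCollect V da db` itself — `decide +kernel` compares it to a literal list via `rpTable`). -/

/-- RP window row in collected form for a concrete table (corollary of `rpRowCollected`). -/
theorem rp_row_collected (k : ℕ) [NeZero (2 * k)] (n m w : ℕ) (hm : m ≤ k) (V : List (List ℤ))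
    (hV : V.length = m) (hrow : ∀ r ∈ V, r.length = w) :
    0 ≤ ∑ a ∈ range (2 * m), ∑ b ∈ range w, (rpCollect V a b : ℝ) * -heisRedCorr2 (2 * k) n a b :=
  rpRowCollected k n m w hm V hV hrow

/-! ### Aggregation for the certificate step: ONE collected row for a whole family of tables
(natural-number weights `Y_r`, so non-negativity is by type; a rational certificate scales to integers first).
The FILER then needs ONE kernel table equation for the combined coefficients instead of one per Gram row. -/

/-- `Σ_r Y_r · rpCollect V_r a b` over a list of weighted tables. -/
def rpCombine : List (ℕ × List (List ℤ)) → ℕ → ℕ → ℤ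
  | [], _, _ => 0
  | (y, V) :: rs, a, b => (y : ℤ) * rpCollect V a b + rpCombine rs a b

/-- **Combined RP row**: a non-negative integer combination of collected RP window rows of common shape `m × w`
(`m ≤ k`) is again a valid collected row. -/
theorem rp_rows_combined (k : ℕ) [NeZero (2 * k)] (n m w : ℕ) (hm : m ≤ k)
    (rows : List (ℕ × List (List ℤ)))
    (hshape : ∀ r ∈ rows, r.2.length = m ∧ ∀ row ∈ r.2, row.length = w) :
    0 ≤ ∑ a ∈ range (2 * m), ∑ b ∈ range w, (rpCombine rows a b : ℝ) * -heisRedCorr2 (2 * k) n a b := by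
  induction rows with
  | nil => simp [rpCombine]
  | cons r rs ih =>
    obtain ⟨y, V⟩ := r
    have hV := hshape (y, V) (by simp)
    have hrs : ∀ r ∈ rs, r.2.length = m ∧ ∀ row ∈ r.2, row.length = w :=
      fun r hr => hshape r (List.mem_cons_of_mem _ hr)
    have h1 := rpRowCollected k n m w hm V hV.1 hV.2
    have h2 := ih hrs
    have hsplit : (∑ a ∈ range (2 * m), ∑ b ∈ range w, (rpCombine ((y, V) :: rs) a b : ℝ) * -heisRedCorr2 (2 * k) n a b) =
        (y : ℝ) * (∑ a ∈ range (2 * m), ∑ b ∈ range w, (rpCollect V a b : ℝ) * -heisRedCorr2 (2 * k) n a b) +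
        ∑ a ∈ range (2 * m), ∑ b ∈ range w, (rpCombine rs a b : ℝ) * -heisRedCorr2 (2 * k) n a b := by
      rw [Finset.mul_sum, ← Finset.sum_add_distrib]
      refine Finset.sum_congr rfl fun a _ => ?_
      rw [Finset.mul_sum, ← Finset.sum_add_distrib]
      refine Finset.sum_congr rfl fun b _ => ?_
      simp only [rpCombine]
      push_cast
      ring
    rw [hsplit]
    have hy : (0 : ℝ) ≤ (y : ℝ) := Nat.cast_nonneg y
    nlinarith

/-! ### Table lookup: replace the computable coefficient function by a literal nested table proved by `decide` -/

/-- If `(range A).map (a ↦ (range w).map (b ↦ f a b)) = T` (one kernel `decide`), the double sum over `range A × range w`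
may be read off the literal table `T`. -/
theorem sum_range_range_eq_table (f : ℕ → ℕ → ℤ) (g : ℕ → ℕ → ℝ) (A w : ℕ) (T : List (List ℤ))
    (hT : ((List.range A).map fun a => (List.range w).map fun b => f a b) = T) :
    ∑ a ∈ range A, ∑ b ∈ range w, (f a b : ℝ) * g a b =
      ∑ a ∈ range A, ∑ b ∈ range w, (((T.getD a []).getD b 0 : ℤ) : ℝ) * g a b := by
  refine Finset.sum_congr rfl fun a ha => Finset.sum_congr rfl fun b hb => ?_
  rw [Finset.mem_range] at ha hb
  subst hT
  have h1 : ((List.range A).map fun a => (List.range w).map fun b => f a b).getD a [] =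
      (List.range w).map fun b => f a b := by
    rw [List.getD_eq_getElem?_getD, List.getElem?_map, List.getElem?_range ha]
    rfl
  have h2 : ((List.range w).map fun b => f a b).getD b 0 = f a b := by
    rw [List.getD_eq_getElem?_getD, List.getElem?_map, List.getElem?_range hb]
    rfl
  rw [h1, h2]

/-- **Combined RP row read off a literal table** (the FILER's entry point): one `decide` for the shape facts, one
`decide +kernel` for the combined coefficient table `T`, then `simp only [Finset.sum_range_succ, …]` expands the
`2m·w`-term linear form. -/
theorem rp_rows_combined_table (k : ℕ) [NeZero (2 * k)] (n m w : ℕ) (hm : m ≤ k)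
    (rows : List (ℕ × List (List ℤ)))
    (hshape : ∀ r ∈ rows, r.2.length = m ∧ ∀ row ∈ r.2, row.length = w) (T : List (List ℤ))
    (hT : ((List.range (2 * m)).map fun a => (List.range w).map fun b => rpCombine rows a b) = T) :
    0 ≤ ∑ a ∈ range (2 * m), ∑ b ∈ range w, (((T.getD a []).getD b 0 : ℤ) : ℝ) * -heisRedCorr2 (2 * k) n a b := by
  rw [← sum_range_range_eq_table (rpCombine rows) (fun a b => -heisRedCorr2 (2 * k) n a b) (2 * m) w T hT]
  exact rp_rows_combined k n m w hm rows hshape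

/-! ### Sanity: the definitions are the computable SPEC functions (kernel `decide` on a 2×2 toy table) -/

/-- `V = [[1,2],[3,4]]`, `w = 2`: the collected RP table, row-major over `a < 5`, `b < 2`. -/
example : rpTable [[1, 2], [3, 4]] 2 = [0, 0, 5, 4, 22, 20, 25, 24, 0, 0] := by decide

/-- combined table `2·V + 3·V'` with `V' = [[1,0],[0,1]]` read through `sum_range_range_eq_table`'s hypothesis shape. -/
example : ((List.range 4).map fun a => (List.range 2).map fun b =>
    rpCombine [(2, [[1, 2], [3, 4]]), (3, [[1, 0], [0, 1]])] a b) = [[0, 0], [13, 8], [44, 46], [53, 48]] := by decide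

/-! ### TEMPLATE (toy, end to end): how a per-certificate file consumes the device.
Two weighted 2×2 tables `2·[[1,2],[3,4]] + 3·[[1,0],[0,1]]`, `m = w = 2`, `k ≥ 2`: the combined collected RP row as an
EXPLICIT linear form in the canonical correlations, obtained by `decide` (shapes), `decide` (table) and `simp only` (expansion). -/

example (k : ℕ) [NeZero (2 * k)] (n : ℕ) (hk : 2 ≤ k) :
    0 ≤ (13 : ℝ) * -heisRedCorr2 (2 * k) n 1 0 + 8 * -heisRedCorr2 (2 * k) n 1 1
      + 44 * -heisRedCorr2 (2 * k) n 2 0 + 46 * -heisRedCorr2 (2 * k) n 2 1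
      + 53 * -heisRedCorr2 (2 * k) n 3 0 + 48 * -heisRedCorr2 (2 * k) n 3 1 := by
  have h := rp_rows_combined_table k n 2 2 hk [(2, [[1, 2], [3, 4]]), (3, [[1, 0], [0, 1]])] (by decide)
    [[0, 0], [13, 8], [44, 46], [53, 48]] (by decide)
  simp only [Finset.sum_range_succ, Finset.sum_range_zero, List.getD_cons_succ, List.getD_cons_zero,
    Int.cast_zero, Int.cast_ofNat, zero_mul, zero_add, add_zero] at h
  linarith

end Summit.HubbardSuperconductivity.HubbardLadder.R91Ra
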